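import Summits.NavierStokesRegularity.NavierStokesRegularity.Theorems.TypeILiouvilleTypeIliouvilleNoTypeIIEternalEnergyLiouvilleSupAttained
import Summits.NavierStokesRegularity.NavierStokesRegularity.Theorems.TypeILiouvilleTypeIliouvilleNoTypeIIEternalEnergyLiouvillePeriodic
import HarnessLib

/-!
# The limit set of an EEL′ profile: closure of the class under translation limits, and vanishing
# of its steady / periodic members (crux `TypeIliouvilleNoTypeII`, stmt-NavierStokesRegularity-0056;
# rigidity residual EEL′ of the pressure-free eternal split)

Helper file (theorems only).  Call the EEL′ CLASS (bound `N`, budget `I`) the bounded eternal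
Oseen-mild smooth divergence-free fields `v` on `ℝ × ℝ³`, `‖v‖ ≤ N`, with Albritton–Barker's
`A_ess, C, E ≤ I` on ALL parabolic balls; EEL′ says the class with `N = 2`, `I < ∞` has `v(0,0) = 0`
(OPEN; its open core is the transient stratum, files `…EternalEnergyCesaro/…Periodic/…Axisym`).  This
file records the dynamical structure of that core:

* `exists_limit_of_translates` — **the class is compact modulo space–time translations**: for ANY
  sequence of translates `v(· + c_k, · + a_k)` a subsequence converges, together with its spatial
  gradients, at every point to a member `W` of the same class (same `N`, same `I`).  (The machinery
  of the sup-attained reduction R3: `mild_translate`, `cknAEss/cknC/cknE_translate`,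
  `ImmortalZoom.exists_tendsto_of_bounded_seq`, `EternalSplit.ckn*_le_of_tendsto`.)  In particular the
  α- and ω-LIMIT SETS of an EEL′ profile (translation limits with `c_k → ∓∞`) lie in the class.
* `eq_zero_of_timeIndependent` — a time-independent member of the class vanishes (the steady
  stratum, `steady_eq_zero_of_cknAEss_le_of_cknE_le`, rephrased for fields `W` with `W t = W 0`);
* `limit_eq_zero_of_steady`, `limit_eq_zero_of_periodic` — **every steady or time-periodic
  translation limit of an EEL′-class profile is identically zero**: an eternal profile of the open
  core cannot settle down to (or emerge from) a nonzero steady state or a nonzero time-periodic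
  motion along any sequence of space–time translations.

WHAT THIS IS NOT: not NS; EEL′ stays OPEN — these are constraints on the transient core, not a
Liouville theorem. [folklore]
-/

noncomputable section

-- the summit and its single problem share the name `NavierStokesRegularity` (D-0017 nested layout)
set_option linter.dupNamespace false

open Set Function Filter Topology MeasureTheory Metric
open scoped NNReal ENNReal

namespace Summit.NavierStokesRegularity.NavierStokesRegularity.Theorems.TypeIliouvilleNoTypeII.TypeIIZoom

open Literature.Analysis Literature.Analysis.FluidPDE
open Summit.NavierStokesRegularity.NavierStokesRegularity.Theorems.TypeIliouvilleNoTypeII.ImmortalZoom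
  (exists_tendsto_of_bounded_seq)
open Summit.NavierStokesRegularity.NavierStokesRegularity.Theorems.TypeIliouvilleNoTypeII.EternalSplit
  (cknAEss_le_of_tendsto cknC_le_of_tendsto cknE_le_of_tendsto)

variable {v : ℝ → EuclideanSpace ℝ (Fin 3) → EuclideanSpace ℝ (Fin 3)}

/-! ## Compactness of the class modulo translations -/

/-- **The EEL′ class is compact modulo space–time translations.**  Let `v` be a bounded eternal
Oseen-mild smooth divergence-free field, `‖v‖ ≤ N`, with `A_ess, C, E ≤ I` on all parabolic balls,
and let `(c_k, a_k)` be any sequence in `ℝ × ℝ³`.  Then along some subsequence `φ` the translates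
`(t, y) ↦ v(t + c_{φ j}, y + a_{φ j})` converge at every point of `ℝ × ℝ³`, together with their spatial
gradients, to a field `W` of the same class: jointly smooth, divergence free, eternal Oseen-mild,
`‖W‖ ≤ N`, and `A_ess, C, E ≤ I` on all parabolic balls. [cite: KochNadirashviliSereginSverak2009, Lemma 6.1 and Prop. 4.1 (arXiv:0709.3599 pp. 8, 11)] -/
theorem exists_limit_of_translates (hv : ContDiff ℝ (⊤ : ℕ∞) (uncurry v))
    (hdiv : ∀ t, VectorCalculus.IsDivFree (v t))
    (hmild : ∀ s t : ℝ, s < t → ∀ x, v t x = heatFlow (v s) (t - s) x - oseenDuhamel 1 s v v t x)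
    {N : ℝ} (hbd : ∀ (t : ℝ) (x : EuclideanSpace ℝ (Fin 3)), ‖v t x‖ ≤ N) {I : ℝ≥0∞}
    (hball : ∀ r : ℝ, 0 < r → ∀ z : ℝ × EuclideanSpace ℝ (Fin 3),
      cknAEss r z v ≤ I ∧ cknC r z v ≤ I ∧ cknE r z (fun s y => fderiv ℝ (v s) y) ≤ I)
    (c : ℕ → ℝ) (a : ℕ → EuclideanSpace ℝ (Fin 3)) :
    ∃ φ : ℕ → ℕ, StrictMono φ ∧
      ∃ W : ℝ → EuclideanSpace ℝ (Fin 3) → EuclideanSpace ℝ (Fin 3),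
        ContDiff ℝ (⊤ : ℕ∞) (uncurry W) ∧ (∀ t, VectorCalculus.IsDivFree (W t)) ∧
        (∀ s t : ℝ, s < t → ∀ x, W t x = heatFlow (W s) (t - s) x - oseenDuhamel 1 s W W t x) ∧
        (∀ t x, ‖W t x‖ ≤ N) ∧
        (∀ r : ℝ, 0 < r → ∀ z : ℝ × EuclideanSpace ℝ (Fin 3),
          cknAEss r z W ≤ I ∧ cknC r z W ≤ I ∧ cknE r z (fun s y => fderiv ℝ (W s) y) ≤ I) ∧
        (∀ t x, Tendsto (fun j => v (t + c (φ j)) (x + a (φ j))) atTop (𝓝 (W t x))) ∧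
        (∀ t x, Tendsto (fun j => fderiv ℝ (fun y => v (t + c (φ j)) (y + a (φ j))) x) atTop
          (𝓝 (fderiv ℝ (W t) x))) := by
  -- the translates
  set w : ℕ → ℝ → EuclideanSpace ℝ (Fin 3) → EuclideanSpace ℝ (Fin 3) :=
    fun k s y => v (s + c k) (y + a k) with hw
  have hwc : ∀ k, ContDiff ℝ (⊤ : ℕ∞) (uncurry (w k)) := fun k => contDiff_translate hv _ _
  have hwdiv : ∀ k t, VectorCalculus.IsDivFree (w k t) := fun k t => isDivFree_translate hdiv _ _ t
  have hwdivw : ∀ k t, IsWeaklyDivFree (w k t) := fun k t =>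
    VectorCalculus.IsDivFree.isWeaklyDivFree_holds (hwdiv k t)
      (((hwc k).comp (contDiff_prodMk_right t)).of_le (by simp))
  have hwmild : ∀ k (s t : ℝ), s < t → ∀ x,
      w k t x = heatFlow (w k s) (t - s) x - oseenDuhamel 1 s (w k) (w k) t x :=
    fun k s t hst x => mild_translate hmild _ _ s t hst x
  have hwbd : ∀ k t x, ‖w k t x‖ ≤ N := fun k t x => hbd _ _
  have hwA : ∀ k (r : ℝ), 0 < r → ∀ z : ℝ × EuclideanSpace ℝ (Fin 3), cknAEss r z (w k) ≤ I :=
    fun k r hr z => by rw [hw, cknAEss_translate hr]; exact (hball r hr _).1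
  have hwC : ∀ k (r : ℝ), 0 < r → ∀ z : ℝ × EuclideanSpace ℝ (Fin 3), cknC r z (w k) ≤ I :=
    fun k r hr z => by rw [hw, cknC_translate hr]; exact (hball r hr _).2.1
  have hwE : ∀ k (r : ℝ), 0 < r → ∀ z : ℝ × EuclideanSpace ℝ (Fin 3),
      cknE r z (fun s y => fderiv ℝ (w k s) y) ≤ I :=
    fun k r hr z => by rw [hw, cknE_translate hr]; exact (hball r hr _).2.2
  -- compactness
  have hB : Tendsto (fun k : ℕ => (k : ℝ) + 1) atTop atTop :=
    tendsto_natCast_atTop_atTop.atTop_add tendsto_const_nhds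
  have hA : Tendsto (fun k : ℕ => -((k : ℝ) + 1)) atTop atBot := tendsto_neg_atTop_atBot.comp hB
  obtain ⟨φ, hφ, W, hW, hWdiv, hWmild, hWbd, hWlim, hWglim⟩ :=
    exists_tendsto_of_bounded_seq N hA hB (w := w)
      (fun k => (hwc k).continuous.continuousOn) (fun k t _ => hwdivw k t)
      (fun k s t _ hst _ x => by
        rw [← heatFlow_of_pos _ (sub_pos.2 hst)]
        exact hwmild k s t hst x)
      (fun k t _ x => hwbd k t x)
  -- `A, C, E ≤ I` pass to the limit
  have hWI : ∀ r : ℝ, 0 < r → ∀ z : ℝ × EuclideanSpace ℝ (Fin 3),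
      cknAEss r z W ≤ I ∧ cknC r z W ≤ I ∧ cknE r z (fun s y => fderiv ℝ (W s) y) ≤ I := by
    intro r hr z
    refine ⟨?_, ?_, ?_⟩
    · exact cknAEss_le_of_tendsto (w := fun j => w (φ j)) (N := N) hr
        (Eventually.of_forall fun j => (hwc (φ j)).continuous.continuousOn)
        (Eventually.of_forall fun j p _ => hwbd (φ j) p.1 p.2)
        (fun p _ => hWlim p.1 p.2) (Eventually.of_forall fun j => hwA (φ j) r hr z)
    · exact cknC_le_of_tendsto (w := fun j => w (φ j)) (N := N) hr
        (Eventually.of_forall fun j => (hwc (φ j)).continuous.continuousOn)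
        (Eventually.of_forall fun j p _ => hwbd (φ j) p.1 p.2)
        (fun p _ => hWlim p.1 p.2) (Eventually.of_forall fun j => hwC (φ j) r hr z)
    · exact cknE_le_of_tendsto (w := fun j => w (φ j)) hr
        (Eventually.of_forall fun j => (continuous_fderiv_slice (hwc (φ j))).continuousOn)
        (fun p _ => hWglim p.1 p.2) (Eventually.of_forall fun j => hwE (φ j) r hr z)
  exact ⟨φ, hφ, W, hW, hWdiv, hWmild, hWbd, hWI, hWlim, hWglim⟩

/-! ## Steady and periodic members of the class vanish -/

variable {W : ℝ → EuclideanSpace ℝ (Fin 3) → EuclideanSpace ℝ (Fin 3)}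

/-- **A time-independent member of the EEL′ class vanishes** (the steady stratum
`steady_eq_zero_of_cknAEss_le_of_cknE_le`, rephrased for a field `W` with `W t = W 0` for all `t`;
only smoothness and the `A_ess`-, `E`-bounds are used). [folklore] -/
theorem eq_zero_of_timeIndependent (hW : ContDiff ℝ (⊤ : ℕ∞) (uncurry W))
    (hsteady : ∀ (t : ℝ) (y : EuclideanSpace ℝ (Fin 3)), W t y = W 0 y) {I : ℝ≥0∞} (hI : I ≠ ⊤)
    (hA : ∀ r : ℝ, 0 < r → ∀ z : ℝ × EuclideanSpace ℝ (Fin 3), cknAEss r z W ≤ I)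
    (hE : ∀ r : ℝ, 0 < r → ∀ z : ℝ × EuclideanSpace ℝ (Fin 3),
      cknE r z (fun s y => fderiv ℝ (W s) y) ≤ I)
    (t : ℝ) (y : EuclideanSpace ℝ (Fin 3)) : W t y = 0 := by
  have hfun : W = fun (_ : ℝ) y => W 0 y := funext fun t => funext fun y => hsteady t y
  have hV : ContDiff ℝ 1 (W 0) := (hW.comp (contDiff_prodMk_right (0 : ℝ))).of_le (by simp)
  have hA' : ∀ r : ℝ, 0 < r → ∀ z : ℝ × EuclideanSpace ℝ (Fin 3),
      cknAEss r z (fun (_ : ℝ) y => W 0 y) ≤ I := by rw [← hfun]; exact hA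
  have hE' : ∀ r : ℝ, 0 < r → ∀ z : ℝ × EuclideanSpace ℝ (Fin 3),
      cknE r z (fun (_ : ℝ) y => fderiv ℝ (W 0) y) ≤ I := by
    have h : (fun (s : ℝ) y => fderiv ℝ (W s) y) = fun (_ : ℝ) y => fderiv ℝ (W 0) y := by
      funext s y
      rw [show W s = W 0 from funext fun y => hsteady s y]
    rw [← h]; exact hE
  rw [hsteady]
  exact steady_eq_zero_of_cknAEss_le_of_cknE_le hV hI hA' hE' y

/-- **Every steady translation limit of an EEL′-class profile is zero.**  If the translates
`v(· + c_k, · + a_k)` of a bounded eternal Oseen-mild smooth divergence-free field with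
`A_ess, C, E ≤ I < ∞` on all balls converge at every point to a TIME-INDEPENDENT field `W`, then
`W ≡ 0`: along a subsequence the limit lies in the class (`exists_limit_of_translates`), limits are
unique, and time-independent members of the class vanish.  In particular the profile cannot settle
down to, or emerge from, a nonzero steady state along any sequence of space–time translations.
[folklore] -/
theorem limit_eq_zero_of_steady (hv : ContDiff ℝ (⊤ : ℕ∞) (uncurry v))
    (hdiv : ∀ t, VectorCalculus.IsDivFree (v t))
    (hmild : ∀ s t : ℝ, s < t → ∀ x, v t x = heatFlow (v s) (t - s) x - oseenDuhamel 1 s v v t x)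
    {N : ℝ} (hbd : ∀ (t : ℝ) (x : EuclideanSpace ℝ (Fin 3)), ‖v t x‖ ≤ N) {I : ℝ≥0∞} (hI : I ≠ ⊤)
    (hball : ∀ r : ℝ, 0 < r → ∀ z : ℝ × EuclideanSpace ℝ (Fin 3),
      cknAEss r z v ≤ I ∧ cknC r z v ≤ I ∧ cknE r z (fun s y => fderiv ℝ (v s) y) ≤ I)
    {c : ℕ → ℝ} {a : ℕ → EuclideanSpace ℝ (Fin 3)}
    (hlim : ∀ t x, Tendsto (fun k => v (t + c k) (x + a k)) atTop (𝓝 (W t x)))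
    (hsteady : ∀ (t : ℝ) (y : EuclideanSpace ℝ (Fin 3)), W t y = W 0 y)
    (t : ℝ) (y : EuclideanSpace ℝ (Fin 3)) : W t y = 0 := by
  obtain ⟨φ, hφ, W', hW', -, -, -, hW'I, hW'lim, -⟩ :=
    exists_limit_of_translates hv hdiv hmild hbd hball c a
  have heq : ∀ t x, W' t x = W t x := fun t x =>
    tendsto_nhds_unique (hW'lim t x) ((hlim t x).comp hφ.tendsto_atTop)
  have hfun : W' = W := funext fun t => funext fun x => heq t x
  rw [hfun] at hW' hW'I
  exact eq_zero_of_timeIndependent hW' hsteady hI (fun r hr z => (hW'I r hr z).1)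
    (fun r hr z => (hW'I r hr z).2.2) t y

/-- **Every time-periodic translation limit of an EEL′-class profile is zero** (same proof, with the
time-periodic stratum `periodic_eq_zero_of_cknAEss_le_of_cknE_le`): the profile cannot approach a
nonzero time-periodic motion along any sequence of space–time translations. [folklore] -/
theorem limit_eq_zero_of_periodic (hv : ContDiff ℝ (⊤ : ℕ∞) (uncurry v))
    (hdiv : ∀ t, VectorCalculus.IsDivFree (v t))
    (hmild : ∀ s t : ℝ, s < t → ∀ x, v t x = heatFlow (v s) (t - s) x - oseenDuhamel 1 s v v t x)
    {N : ℝ} (hbd : ∀ (t : ℝ) (x : EuclideanSpace ℝ (Fin 3)), ‖v t x‖ ≤ N) {I : ℝ≥0∞} (hI : I ≠ ⊤)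
    (hball : ∀ r : ℝ, 0 < r → ∀ z : ℝ × EuclideanSpace ℝ (Fin 3),
      cknAEss r z v ≤ I ∧ cknC r z v ≤ I ∧ cknE r z (fun s y => fderiv ℝ (v s) y) ≤ I)
    {c : ℕ → ℝ} {a : ℕ → EuclideanSpace ℝ (Fin 3)}
    (hlim : ∀ t x, Tendsto (fun k => v (t + c k) (x + a k)) atTop (𝓝 (W t x)))
    (hP : ∃ P : ℝ, 0 < P ∧ ∀ (t : ℝ) (x : EuclideanSpace ℝ (Fin 3)), W (t + P) x = W t x)
    (t : ℝ) (y : EuclideanSpace ℝ (Fin 3)) : W t y = 0 := by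
  obtain ⟨φ, hφ, W', hW', -, -, -, hW'I, hW'lim, -⟩ :=
    exists_limit_of_translates hv hdiv hmild hbd hball c a
  have heq : ∀ t x, W' t x = W t x := fun t x =>
    tendsto_nhds_unique (hW'lim t x) ((hlim t x).comp hφ.tendsto_atTop)
  have hfun : W' = W := funext fun t => funext fun x => heq t x
  rw [hfun] at hW' hW'I
  exact periodic_eq_zero_of_cknAEss_le_of_cknE_le hW' hP
    ⟨I, hI, fun r hr z => ⟨(hW'I r hr z).1, (hW'I r hr z).2.2⟩⟩ t y

end Summit.NavierStokesRegularity.NavierStokesRegularity.Theorems.TypeIliouvilleNoTypeII.TypeIIZoom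

end
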